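import Summits.Langlands.Langlands.Theses.DyadicOddResidue
import Literature.NumberTheory.GaloisRepresentations.CalegariEvenFontaineMazurTwo

/-!
# `DyadicEisensteinFM` (stmt-Langlands-18741) — negative knowledge I: at `ℓ = 2` oddness is
# residually invisible (complex conjugation is residually unipotent)

Support lemmas of the standing disprover (`Cruxes/DyadicEisensteinFM/Disproof.lean`, cycle 1, §0;
refuter-cdisprove-stmt-Langlands-18741-0, 2026-08-17), on the hypothesis `ρ.IsOdd` of
`Summit.Langlands.Langlands.Theses.DyadicOddResidue.DyadicEisensteinFM` at its prime `ℓ = 2`.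

The route names as first obstruction that "mod `2` oddness is invisible (`ρ̄(c) = 1` possible), so
Skinner–Wiles's splitting by `ρ(c)` fails".  Kernel-checked form: in characteristic `2` an
involution is UNIPOTENT (`matrix_sub_one_mul_self_eq_zero`: `A² = 1 ⟹ (A - 1)² = 0`), hence for
EVERY homomorphism `τ : Γ_K → GL_n(k)` with `char k = 2` — every reduction and every residual
representation of every `ρ : Γ_K → GL_n(ℚ̄₂)`, odd OR even — and every complex conjugation `c`:
`(τ(c) - 1)² = 0` and `det τ(c) = 1` (`residual_complexConjugation_unipotent`,
`residual_det_complexConjugation_eq_one`, `reduction_two_complexConjugation`).  On the semisimple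
Eisenstein residue `ρ̄^ss = χ̄₁ ⊕ χ̄₂` of this crux (abelian image) this forces `ρ̄^ss(c) = 1`
outright: there are no `±1`-eigenlines of `c` to split the residual pseudo-representation.
Contrast, for the record (any `ℓ`): the determinant of a reduction is the reduction of the
determinant (`det_reduction`), so a reduction of an ODD `ρ` has `det τ(c) = -1`
(`det_reduction_complexConjugation`) and `τ(c) ≠ 1` as soon as `char k ≠ 2`
(`reduction_complexConjugation_ne_one`) — the DDT §2 / Skinner–Wiles (Publ. IHÉS 89, §2) input
available at every odd `ℓ` and lost exactly at `ℓ = 2`.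

Nothing here asserts a route statement.  Imports the route file (vocabulary cone) and
`CalegariEvenFontaineMazurTwo` (for the PROVED `charP_padicAlgClResidueField`). [folklore]
-/

set_option linter.dupNamespace false -- project-wide option; `Summit.Langlands.Langlands` is the mandated namespace

noncomputable section

open scoped MatrixGroups
open Matrix
open Literature.NumberTheory.GaloisRepresentations

namespace Summit.Langlands.Langlands.Theorems.DyadicEisensteinFM.Negative

/-! ### Characteristic `2`: involutions are unipotent -/

section CharTwo

variable {k : Type*} [Field k]

/-- **In characteristic `2` an involution is unipotent**: `A² = 1 ⟹ (A - 1)² = A² - 2A + 1 = 0`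
for square matrices over a field of characteristic `2`. [folklore] -/
theorem matrix_sub_one_mul_self_eq_zero [CharP k 2] {m : Type*} [Fintype m] [DecidableEq m]
    (A : Matrix m m k) (hA : A * A = 1) : (A - 1) * (A - 1) = 0 := by
  have h : (A - 1) * (A - 1) = A * A + 1 - (A + A) := by noncomm_ring
  have h2 : A + A = 0 := by
    ext i j
    simp [CharTwo.add_self_eq_zero]
  have h1 : (1 : Matrix m m k) + 1 = 0 := by
    ext i j
    by_cases hij : i = j
    · subst hij
      simp [CharTwo.add_self_eq_zero]
    · simp [hij]
  rw [h, hA, h2, sub_zero, h1]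

/-- For a homomorphism `τ : G → GL_n(k)`, `char k = 2`, and `c ∈ G` with `c² = 1`:
`(τ(c) - 1)² = 0` (as matrices). [folklore] -/
theorem gl_sub_one_mul_self_eq_zero [CharP k 2] {G : Type*} [Group G] {n : ℕ}
    (τ : G →* GL (Fin n) k) {c : G} (hc : c ^ 2 = 1) :
    (((τ c : GL (Fin n) k) : Matrix (Fin n) (Fin n) k) - 1) *
      (((τ c : GL (Fin n) k) : Matrix (Fin n) (Fin n) k) - 1) = 0 := by
  apply matrix_sub_one_mul_self_eq_zero
  rw [← Matrix.GeneralLinearGroup.coe_mul, ← map_mul, ← pow_two, hc, map_one,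
    Matrix.GeneralLinearGroup.coe_one]

/-- For a homomorphism `τ : G → GL_n(k)`, `char k = 2`, and `c ∈ G` with `c² = 1`:
`det τ(c) = 1` (`x² = 1 ⟹ (x - 1)² = 0 ⟹ x = 1` in a field of characteristic `2`). [folklore] -/
theorem gl_det_eq_one_of_sq_eq_one [CharP k 2] {G : Type*} [Group G] {n : ℕ}
    (τ : G →* GL (Fin n) k) {c : G} (hc : c ^ 2 = 1) :
    Matrix.GeneralLinearGroup.det (τ c) = 1 := by
  have hu : Matrix.GeneralLinearGroup.det (τ c) ^ 2 = 1 := by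
    rw [← map_pow, ← map_pow, hc, map_one, map_one]
  set x : k := ((Matrix.GeneralLinearGroup.det (τ c) : kˣ) : k) with hxdef
  have hx : x ^ 2 = 1 := by
    have h := congrArg Units.val hu
    simpa [hxdef] using h
  have h0 : (x - 1) ^ 2 = 0 := by
    rw [sub_sq, hx, CharTwo.two_eq_zero, zero_mul, zero_mul, sub_zero, one_pow,
      CharTwo.add_self_eq_zero]
  have hx1 : x = 1 := sub_eq_zero.mp ((pow_eq_zero_iff two_ne_zero).mp h0)
  exact Units.ext (by rw [Units.val_one]; exact hx1)

/-- Any field receiving the residue field `ℤ̄₂/𝔪` of `ℚ̄₂` has characteristic `2`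
(`charP_padicAlgClResidueField`, `charP_of_injective_ringHom`). [folklore] -/
theorem charP_two_of_residueField_ringHom (ι : padicAlgClResidueField 2 →+* k) : CharP k 2 :=
  haveI := charP_padicAlgClResidueField 2
  charP_of_injective_ringHom ι.injective 2

/-- **Complex conjugation is residually unipotent at `ℓ = 2`.**  For every field `K` with a real
embedding `φ`, every complex conjugation `c` for `φ` (`IsComplexConjugation`, an involution:
`IsComplexConjugation.sq_eq_one`), every field `k` of characteristic `2` and EVERY homomorphism
`τ : Γ_K → GL_n(k)` — in particular every reduction and every residual representation, along any
`ι : ℤ̄₂/𝔪 →+* k`, of every `ρ : Γ_K → GL_n(ℚ̄₂)`, odd or even —: `(τ(c) - 1)² = 0`.  So `τ(c)` is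
`1` or (for `n = 2`) conjugate to `(1 1; 0 1)`; on a semisimple `τ` with abelian image (the
Eisenstein residue `χ̄₁ ⊕ χ̄₂`) `τ(c) = 1` outright. [folklore] -/
theorem residual_complexConjugation_unipotent {K : Type*} [Field K] [CharP k 2] {n : ℕ}
    (τ : Field.absoluteGaloisGroup K →* GL (Fin n) k) {φ : K →+* ℝ}
    {c : Field.absoluteGaloisGroup K} (hc : IsComplexConjugation φ c) :
    (((τ c : GL (Fin n) k) : Matrix (Fin n) (Fin n) k) - 1) *
      (((τ c : GL (Fin n) k) : Matrix (Fin n) (Fin n) k) - 1) = 0 :=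
  gl_sub_one_mul_self_eq_zero τ hc.sq_eq_one

/-- **`det ρ̄(c) = 1` at `ℓ = 2`, for every mod-`2` representation, odd or even**: the residual
determinant of complex conjugation carries no sign. [folklore] -/
theorem residual_det_complexConjugation_eq_one {K : Type*} [Field K] [CharP k 2] {n : ℕ}
    (τ : Field.absoluteGaloisGroup K →* GL (Fin n) k) {φ : K →+* ℝ}
    {c : Field.absoluteGaloisGroup K} (hc : IsComplexConjugation φ c) :
    Matrix.GeneralLinearGroup.det (τ c) = 1 :=
  gl_det_eq_one_of_sq_eq_one τ hc.sq_eq_one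

/-- The same for reductions of `ρ : Γ_K → GL_n(ℚ̄₂)` along any residue embedding
`ι : ℤ̄₂/𝔪 →+* k` (then `char k = 2`): whatever the parity of `ρ`, every reduction `τ` of `ρ`
(`FramedGaloisRep.IsReductionOf`) has `det τ(c) = 1` and unipotent `τ(c)`.  The reduction
hypothesis is not even used — that is the point. [folklore] -/
theorem reduction_two_complexConjugation {K : Type*} [Field K] {n : ℕ}
    (ρ : FramedGaloisRep K (PadicAlgCl 2) n) (ι : padicAlgClResidueField 2 →+* k)
    {τ : Field.absoluteGaloisGroup K →* GL (Fin n) k} (_hτ : ρ.IsReductionOf ι τ) {φ : K →+* ℝ}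
    {c : Field.absoluteGaloisGroup K} (hc : IsComplexConjugation φ c) :
    Matrix.GeneralLinearGroup.det (τ c) = 1 ∧
      (((τ c : GL (Fin n) k) : Matrix (Fin n) (Fin n) k) - 1) *
        (((τ c : GL (Fin n) k) : Matrix (Fin n) (Fin n) k) - 1) = 0 :=
  haveI := charP_two_of_residueField_ringHom ι
  ⟨residual_det_complexConjugation_eq_one τ hc, residual_complexConjugation_unipotent τ hc⟩

end CharTwo

/-! ### Contrast (any `ℓ`): what oddness gives residually when `char k ≠ 2` -/

section AnyPrime

variable {F : Type*} [Field F] {O : ValuationSubring F} {n : ℕ} {G : Type*} [Group G]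
  {k : Type*} [Field k]

/-- **The determinant of a reduction is the reduction of the determinant**: if `τ` is a reduction
of `ρ : G → GL_n(F)` along `ι : O/𝔪 →+* k` (`IsReductionOf`: `τ = Q (ρ₀ mod 𝔪) Q⁻¹`,
`ρ₀ = P⁻¹ ρ P` integral), then for every `g` there is a unit `d ∈ Oˣ` (namely `det ρ₀(g)`) with
`d = det ρ(g)` in `F` and `det τ(g) = ι(d mod 𝔪)`. [folklore] -/
theorem det_reduction {ι : IsLocalRing.ResidueField O →+* k} {ρ : G →* GL (Fin n) F}
    {τ : G →* GL (Fin n) k}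
    (h : Literature.NumberTheory.GaloisRepresentations.IsReductionOf ι ρ τ) (g : G) :
    ∃ d : Oˣ, Units.map (O.subtype : O →* F) d = Matrix.GeneralLinearGroup.det (ρ g) ∧
      Matrix.GeneralLinearGroup.det (τ g) =
        Units.map ((ι.comp (IsLocalRing.residue O) : O →+* k) : O →* k) d := by
  obtain ⟨ρ₀, Q, ⟨P, hP⟩, hQ⟩ := h
  refine ⟨Matrix.GeneralLinearGroup.det (ρ₀ g), ?_, ?_⟩
  · rw [← Matrix.GeneralLinearGroup.map_det, hP g, map_mul, map_mul, map_inv, inv_mul_cancel_comm]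
  · rw [hQ g, map_mul, map_mul, map_inv, mul_inv_cancel_comm]
    exact Matrix.GeneralLinearGroup.map_det _ _

/-- **A reduction of an odd representation is odd**: for `ρ : Γ_K → GL_n(ℚ̄_ℓ)` odd, every
reduction `τ` along any `ι : ℤ̄_ℓ/𝔪 →+* k` and every complex conjugation `c`:
`det τ(c) = -1` in `k`.  (At `ℓ = 2` this says `det τ(c) = 1`, cf.
`residual_det_complexConjugation_eq_one`.) [folklore] -/
theorem det_reduction_complexConjugation {K : Type*} [Field K] {ℓ : ℕ} [Fact ℓ.Prime]
    {ρ : FramedGaloisRep K (PadicAlgCl ℓ) n} (hodd : ρ.IsOdd) {ι : padicAlgClResidueField ℓ →+* k}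
    {τ : Field.absoluteGaloisGroup K →* GL (Fin n) k} (hτ : ρ.IsReductionOf ι τ) {φ : K →+* ℝ}
    {c : Field.absoluteGaloisGroup K} (hc : IsComplexConjugation φ c) :
    ((Matrix.GeneralLinearGroup.det (τ c) : kˣ) : k) = -1 := by
  obtain ⟨d, hd, hτd⟩ := det_reduction hτ c
  have hρ : Matrix.GeneralLinearGroup.det
      ((ρ : Field.absoluteGaloisGroup K →* GL (Fin n) (PadicAlgCl ℓ)) c) = -1 := hodd φ c hc
  rw [hρ] at hd
  have hdF : ((d : padicAlgClIntegers ℓ) : PadicAlgCl ℓ) = -1 := by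
    have h := congrArg Units.val hd
    rw [Units.coe_map] at h
    simpa using h
  have hdO : (d : padicAlgClIntegers ℓ) = -1 := by
    apply Subtype.val_injective
    simpa using hdF
  rw [hτd, Units.coe_map]
  simp [hdO]

/-- **… hence `τ(c) ≠ 1` whenever `char k ≠ 2`** (in particular for every odd prime `ℓ`, where
`char k = ℓ`): complex conjugation is residually a NON-TRIVIAL involution with `det = -1 ≠ 1` —
the splitting used by Skinner–Wiles and Bellaïche–Chenevier for residually reducible odd `ρ` at
odd `ℓ`, unavailable at `ℓ = 2` (`residual_complexConjugation_unipotent`). [folklore] -/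
theorem reduction_complexConjugation_ne_one {K : Type*} [Field K] {ℓ : ℕ} [Fact ℓ.Prime]
    {ρ : FramedGaloisRep K (PadicAlgCl ℓ) n} (hodd : ρ.IsOdd) {ι : padicAlgClResidueField ℓ →+* k}
    (hk : ringChar k ≠ 2) {τ : Field.absoluteGaloisGroup K →* GL (Fin n) k}
    (hτ : ρ.IsReductionOf ι τ) {φ : K →+* ℝ} {c : Field.absoluteGaloisGroup K}
    (hc : IsComplexConjugation φ c) : τ c ≠ 1 := by
  intro h1
  have h := det_reduction_complexConjugation hodd hτ hc
  rw [h1, map_one, Units.val_one] at h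
  exact Ring.neg_one_ne_one_of_char_ne_two hk h.symm

end AnyPrime

end Summit.Langlands.Langlands.Theorems.DyadicEisensteinFM.Negative

end
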